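import Summits.QuantumFields.QCD.Theorems.RobustYangMillsHandover.Negative.SchemeAsymptotics

/-!
# Line `gap-upset-recut` for `ChiralDescent` (crux stmt-QuantumFields-17527) — a structural lemma for stub Q1
# `stub_chiralPointOfBodyEverywhere` (lead a1, cycle 1; `--supports`, the stub itself is NOT claimed)

The registered stub Q1 of `Cruxes/ChiralDescent/Lines/gap_upset_recut.lean` (verbatim the shared stub H2 of the dead
line `Sketch`) says, for `N_f ∈ {2,3}` and a mass-scaling regularisation `reg`: if the body of the re-typed conjunct
(`IsQCDAlong` + non-trivial non-Gaussian glue + dynamical quarks + OS and lattice gap) holds at EVERY real tuple of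
renormalised masses, then above some offset `μ` the lattice gap closes (`∀ ε > 0` some tuple above `μ` has no uniform
lattice rate `ε`).  Q1 is implied by the OPEN item stmt-QuantumFields-18328 `QuarksAsStableAction.ChiralTupleGapless`
through the landed adapter `Cruxes.ChiralDescent.InfimumDescent.chiralPointOfBodyEverywhere_of_chiralTupleGapless`
(p139859); its conclusion needs a LOWER bound on a lattice-QCD connected correlator frequently in `k`, which nothing in
the tree supplies, and it is not proved here.

What IS recorded, kernel-checked, is what the HYPOTHESIS of Q1 says about the regularisation alone.  The branch clause
of `IsQCDAlong` (eventually `−1 < m_f(k) = m_crit(k) + a_k m_f / Z_m(k)`), read at the flavour-constant tuple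
`(−N, …, −N)`, is `N < (m_crit(k) + 1) Z_m(k) / a_k` eventually; so a body — even just the branch clause — at every
real tuple forces the critical mass INFINITELY FAR ABOVE THE WALL `−1` in units of the mass increment `a_k / Z_m(k)`:

* `tendsto_mcritMargin_atTop_of_isQCDAlong_everywhere` — `(m_crit(k) + 1) Z_m(k) / a_k → +∞`;
* `forall_eventually_branch_iff_tendsto_mcritMargin` — conversely this divergence gives the branch clause at every
  real tuple, so it is EXACTLY the body-free content of "branch clause everywhere";
* `tendsto_mcritMargin_atTop_of_bodyEverywhere` — the corollary from Q1's full hypothesis (first conjunct);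
* `eventually_neg_one_lt_mcrit_of_isQCDAlong_zero` — at the tuple `0` the branch clause is `−1 < m_crit(k)` eventually;
* `exists_hasMassScaling_tendsto_mcritMargin_not_interior` — SHARPNESS: a mass-scaling regularisation (`N_f ≤ 16`)
  with infinite margin whose critical masses tend to the wall `−1`, so it is not interior.

The hypothesis of Q1 is thus the opposite extreme of the wall regime of the neighbouring stub W (`m_crit(k) < c`
frequently for every `c > −1`) in units of `a_k / Z_m(k)`, but it does NOT make `reg` interior
(`∃ c > −1, ∀ᶠ k, c ≤ m_crit(k)`, the hypothesis of the stubs Q2/Q3): under `HasMassScaling` the unit `a_k / Z_m(k)`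
tends to `0` (`tendsto_massIncrement_zero`), and `m_crit(k) = −1 + a_k` has infinite margin `Z_m(k) → ∞`.  (In the
line's composition `ChiralDescent_of_stubs` Q1 is invoked only in the interior branch.)  Pure bookkeeping over
`QCDOS.lean` and `Negative/SchemeAsymptotics` (`tendsto_Zm_atTop`); standard axioms.
-/

namespace Summit.QuantumFields.QCD.Cruxes.ChiralDescent.GapUpsetRecut

open Filter Topology
open Literature.MathematicalPhysics.QuantumFieldTheory
open Summit.QuantumFields.QCD.Theorems.RobustYangMillsHandover.Negative (tendsto_Zm_atTop)

variable {Nf : ℕ}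

/-- **The branch clause as a margin bound.** For a regularisation `reg`, a real `x` and an index `k`,
`−1 < m_crit(k) + a_k x / Z_m(k)` iff `−x < (m_crit(k) + 1) Z_m(k) / a_k` (multiply through by `Z_m(k) / a_k > 0`).
[folklore] -/
theorem neg_one_lt_mcrit_add_iff (reg : QCDRegularisation Nf) (x : ℝ) (k : ℕ) :
    -1 < reg.mcrit k + reg.a k * x / reg.Zm k ↔ -x < (reg.mcrit k + 1) * reg.Zm k / reg.a k := by
  have ha : 0 < reg.a k := reg.a_pos k
  have hZ : 0 < reg.Zm k := reg.Zm_pos k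
  rw [lt_div_iff₀ ha]
  constructor
  · intro h
    have h2 : -1 * reg.Zm k < (reg.mcrit k + reg.a k * x / reg.Zm k) * reg.Zm k := mul_lt_mul_of_pos_right h hZ
    rw [add_mul, div_mul_cancel₀ _ hZ.ne'] at h2
    nlinarith
  · intro h
    have h2 : -x * reg.a k / reg.Zm k < (reg.mcrit k + 1) * reg.Zm k / reg.Zm k := div_lt_div_of_pos_right h hZ
    rw [mul_div_cancel_right₀ _ hZ.ne'] at h2
    have h3 : -x * reg.a k / reg.Zm k = -(reg.a k * x / reg.Zm k) := by ring
    linarith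

/-- **The branch clause of `IsQCDAlong` at one tuple, as a margin bound.** If OS data `T` are QCD along the scheme of
`reg` at the tuple `m` (any species renormalisations), then for every flavour `f`, eventually
`−m_f < (m_crit(k) + 1) Z_m(k) / a_k`. [folklore] -/
theorem eventually_neg_lt_mcritMargin_of_isQCDAlong (reg : QCDRegularisation Nf) {m : Fin Nf → ℝ}
    {z shift : QCDField Nf → ℕ → ℝ} {T : OSData (QCDField Nf) 4} (h : IsQCDAlong (reg.scheme m z shift) T)
    (f : Fin Nf) : ∀ᶠ k in atTop, -m f < (reg.mcrit k + 1) * reg.Zm k / reg.a k := by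
  filter_upwards [h.2.1 f] with k hk
  rw [QCDRegularisation.scheme_mq] at hk
  exact (neg_one_lt_mcrit_add_iff reg (m f) k).1 hk

/-- **A body (even just the branch clause of `IsQCDAlong`) at EVERY real tuple forces the critical mass infinitely far
above the wall `−1` in units of `a_k / Z_m(k)`**: if `0 < N_f` and every real tuple `m` admits species renormalisations
and OS data that are QCD along `reg.scheme m`, then `(m_crit(k) + 1) Z_m(k) / a_k → +∞` — the branch clause at the
constant tuple `(−N, …, −N)` reads `N < (m_crit(k) + 1) Z_m(k) / a_k` eventually.  The hypothesis of Q1 is the opposite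
extreme of the wall regime of W. [folklore] -/
theorem tendsto_mcritMargin_atTop_of_isQCDAlong_everywhere (hNf : 0 < Nf) (reg : QCDRegularisation Nf)
    (h : ∀ m : Fin Nf → ℝ, ∃ (z shift : QCDField Nf → ℕ → ℝ) (T : OSData (QCDField Nf) 4),
      IsQCDAlong (reg.scheme m z shift) T) :
    Tendsto (fun k => (reg.mcrit k + 1) * reg.Zm k / reg.a k) atTop atTop := by
  refine tendsto_atTop.2 fun N => ?_
  obtain ⟨z, shift, T, hT⟩ := h fun _ => -N
  filter_upwards [eventually_neg_lt_mcritMargin_of_isQCDAlong reg hT ⟨0, hNf⟩] with k hk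
  rw [neg_neg] at hk
  exact hk.le

/-- **The divergence of the margin is EXACTLY the branch clause at every real tuple** (body-free form): for `0 < N_f`,
`−1 < m_crit(k) + a_k m_f / Z_m(k)` eventually for every real tuple `m` and flavour `f` iff
`(m_crit(k) + 1) Z_m(k) / a_k → +∞`. [folklore] -/
theorem forall_eventually_branch_iff_tendsto_mcritMargin (hNf : 0 < Nf) (reg : QCDRegularisation Nf) :
    (∀ m : Fin Nf → ℝ, ∀ f : Fin Nf, ∀ᶠ k in atTop, -1 < reg.mcrit k + reg.a k * m f / reg.Zm k) ↔
      Tendsto (fun k => (reg.mcrit k + 1) * reg.Zm k / reg.a k) atTop atTop := by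
  constructor
  · intro h
    refine tendsto_atTop.2 fun N => ?_
    filter_upwards [h (fun _ => -N) ⟨0, hNf⟩] with k hk
    have hk' := (neg_one_lt_mcrit_add_iff reg (-N) k).1 hk
    rw [neg_neg] at hk'
    exact hk'.le
  · intro h m f
    filter_upwards [h.eventually_gt_atTop (-m f)] with k hk
    exact (neg_one_lt_mcrit_add_iff reg (m f) k).2 hk

/-- `N_f ∈ {2,3}` is positive. [folklore] -/
theorem nf_pos_of_two_or_three (hNf : Nf = 2 ∨ Nf = 3) : 0 < Nf := by
  rcases hNf with rfl | rfl <;> norm_num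

/-- **Corollary for Q1's full hypothesis.** For `N_f ∈ {2,3}`: if the body of the re-typed conjunct holds at EVERY real
tuple of the regularisation `reg`, then `(m_crit(k) + 1) Z_m(k) / a_k → +∞` (project the `IsQCDAlong` conjunct and apply
`tendsto_mcritMargin_atTop_of_isQCDAlong_everywhere`). [folklore] -/
theorem tendsto_mcritMargin_atTop_of_bodyEverywhere :
    ∀ Nf : ℕ, (Nf = 2 ∨ Nf = 3) → ∀ reg : QCDRegularisation Nf,
      (∀ m : Fin Nf → ℝ,
        ∃ (z shift : QCDField Nf → ℕ → ℝ) (T : OSData (QCDField Nf) 4),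
          IsQCDAlong (reg.scheme m z shift) T ∧ T.IsNontrivial QCDField.glue ∧ T.IsNonGaussian QCDField.glue ∧
            (∀ f g : Fin Nf, f ≠ g → T.IsNontrivial (QCDField.pseudoRe f g)) ∧
              ∃ Δ > 0, T.HasMassGap Δ ∧ (reg.scheme m z shift).HasLatticeMassGap Δ) →
      Tendsto (fun k => (reg.mcrit k + 1) * reg.Zm k / reg.a k) atTop atTop :=
  fun _ hNf reg hbody =>
    tendsto_mcritMargin_atTop_of_isQCDAlong_everywhere (nf_pos_of_two_or_three hNf) reg fun m => by
      obtain ⟨z, shift, T, hT, -⟩ := hbody m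
      exact ⟨z, shift, T, hT⟩

/-- **At the tuple `0` the branch clause is a statement about `m_crit` alone**: if `0 < N_f` and OS data `T` are QCD
along `reg.scheme 0 z shift`, then `−1 < m_crit(k)` eventually (`m_f(k) = m_crit(k) + a_k · 0 / Z_m(k) = m_crit(k)`).
[folklore] -/
theorem eventually_neg_one_lt_mcrit_of_isQCDAlong_zero (hNf : 0 < Nf) (reg : QCDRegularisation Nf)
    {z shift : QCDField Nf → ℕ → ℝ} {T : OSData (QCDField Nf) 4} (h : IsQCDAlong (reg.scheme 0 z shift) T) :
    ∀ᶠ k in atTop, -1 < reg.mcrit k := by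
  filter_upwards [h.2.1 ⟨0, hNf⟩] with k hk
  simpa [QCDRegularisation.scheme_mq] using hk

/-- **At a constant tuple `(μ, …, μ)` the branch clause is the branch hypothesis of the `m_crit`-shift of `reg` by
`μ`**: if `0 < N_f` and OS data are QCD along `reg.scheme (fun _ => μ) z shift`, then
`−1 < m_crit(k) + a_k μ / Z_m(k)` eventually — for Q1's hypothesis this holds at EVERY real `μ`, negative ones included
(no interiority or mass-scaling hypothesis needed, unlike `eventually_neg_one_lt_mcrit_shift` of the line). [folklore] -/
theorem eventually_neg_one_lt_mcrit_shift_of_isQCDAlong_const (hNf : 0 < Nf) (reg : QCDRegularisation Nf) (μ : ℝ)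
    {z shift : QCDField Nf → ℕ → ℝ} {T : OSData (QCDField Nf) 4}
    (h : IsQCDAlong (reg.scheme (fun _ => μ) z shift) T) :
    ∀ᶠ k in atTop, (-1 : ℝ) < reg.mcrit k + reg.a k * μ / reg.Zm k := by
  filter_upwards [h.2.1 ⟨0, hNf⟩] with k hk
  simpa [QCDRegularisation.scheme_mq] using hk

/-- **An infinite margin does NOT make the regularisation interior** (why Q1's hypothesis cannot be fed to the interior
stubs Q2/Q3 through the margin alone): for `N_f ≤ 16` there is a MASS-SCALING regularisation with
`(m_crit(k) + 1) Z_m(k) / a_k → +∞` — so, by `forall_eventually_branch_iff_tendsto_mcritMargin`, the branch clause holds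
at every real tuple — whose critical masses nevertheless tend to the wall, `m_crit(k) → −1⁺`, so that no `c > −1` bounds
them below eventually.  Witness: `canonicalAF` re-pinned at `m_crit(k) = −1 + a_k`; its margin is `Z_m(k) → ∞`
(`tendsto_Zm_atTop`). [folklore] -/
theorem exists_hasMassScaling_tendsto_mcritMargin_not_interior (hNf : Nf ≤ 16) :
    ∃ reg : QCDRegularisation Nf, reg.HasMassScaling ∧
      Tendsto (fun k => (reg.mcrit k + 1) * reg.Zm k / reg.a k) atTop atTop ∧
        ¬ ∃ c : ℝ, -1 < c ∧ ∀ᶠ k in atTop, c ≤ reg.mcrit k := by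
  refine ⟨{ QCDRegularisation.canonicalAF Nf with mcrit := fun k => -1 + (QCDRegularisation.canonicalAF Nf).a k },
    QCDRegularisation.canonicalAF_hasMassScaling, ?_, ?_⟩
  · have hZ := tendsto_Zm_atTop hNf (QCDRegularisation.canonicalAF Nf) QCDRegularisation.canonicalAF_hasMassScaling
    refine hZ.congr fun k => ?_
    have ha : (QCDRegularisation.canonicalAF Nf).a k ≠ 0 := ((QCDRegularisation.canonicalAF Nf).a_pos k).ne'
    change (QCDRegularisation.canonicalAF Nf).Zm k =
      (-1 + (QCDRegularisation.canonicalAF Nf).a k + 1) * (QCDRegularisation.canonicalAF Nf).Zm k /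
        (QCDRegularisation.canonicalAF Nf).a k
    field_simp
    ring
  · rintro ⟨c, hc, hev⟩
    have ha : Tendsto (fun k => -1 + (QCDRegularisation.canonicalAF Nf).a k) atTop (𝓝 (-1 + 0)) :=
      tendsto_const_nhds.add (QCDRegularisation.canonicalAF Nf).tendsto_a
    rw [add_zero] at ha
    obtain ⟨k, hk₁, hk₂⟩ := (hev.and ((tendsto_order.1 ha).2 c hc)).exists
    exact absurd hk₁ (not_le.2 hk₂)

end Summit.QuantumFields.QCD.Cruxes.ChiralDescent.GapUpsetRecut
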